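import Summits.Ventures.LatticeQCDFlow.Scaling.LumpedStarClockDecay

/-!
HONEST FRAMING: exact (Metropolis-corrected) sampling algorithms for lattice gauge theory; figures
of merit are autocorrelation/cost numbers at stated couplings and volumes; no continuum-physics
claim.

# LumpedStarClockMixingTime — OPEN-MATH ITEM 1 (i) (b′), THE SHARP STEP LOGARITHM: THE STEP CHAIN OF THE LUMPED STAR HAS `t_mix(ε₀) ≤ ⌈(log(1/ε₀) + log(2D/r))/log(1 + (1−σ)r/48)⌉`,
# `r = σp̄/(c+2K+2)`, `D = (K+1)(c+2K+2) + 2(K+1)(c+2K+6)` (`p̄ = pE_{μ0}[Wθ]`, any `c ≥ 2K+4`, `K ≥ 2`); AT `c = 2K+4`: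
# `t_mix(ε₀) ≤ ⌈(192(2K+3)/((1−σ)σp̄))·(log(1/ε₀) + log(8(K+1)(6K+13)(2K+3)/(σp̄)))⌉` — ORDER `(K/((1−σ)σp̄))·log(K/(σp̄ε₀))`, UNCONDITIONAL (lean-2 GEN-44, ours)

Venture-side (OURS).  Cell `lqcd-flow` (pub-lqcd), unit `pub-lqcd-lean-2-g44`, 2026-08-31.  Chapter AD, file 4 = the mixing time read off file 3's law `d(n) ≤ (2D/r)(1+ε)⁻ⁿ`
(`ε = (1−σ)r/48`) exactly as chapter AC file 4 reads its law: `d(N) ≤ ε₀` once `N ≥ (log(1/ε₀) + log(2D/r))/log(1+ε)`; and the closed form at `c = 2K+4` by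
`log(1+ε) ≥ ε/(1+ε) ≥ ε/2` (`ε ≤ 1`), `2D/r = 8(K+1)(6K+13)(2K+3)/(σp̄)`, `2/ε = 192(2K+3)/((1−σ)σp̄)`.  Hypotheses: those of file 3 (the lumped star of chapter W file 27 with the
tagged chains and tail resolvents of every oriented adjacent pair by their hypothesis-equations, X5's step objects, `K ≥ 2`, `0 < σ < 1`, `μ_0 > 0`, `p̄ > 0`), `0 < ε₀` (`≤ 1` for the
closed form).

* **`lumpedStar_clock_mixingTime_le`**, **`lumpedStar_clock_mixingTime_le_twoK`**.

Reading (no numerics implied): compare X6 `lumpedStar_step_mixingTime_le_twoK` — `⌈((2K+2)/((1−σ)σp̄))·(½log(1/π_min) + log(1/(2ε)))⌉` by the spectral route, with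
`½log(1/π_min) = O(K·log(1/min μ_0W))`; here the logarithm is `log(K³/(σp̄ε₀))`, law-free: OPEN-MATH (b′) route (β) closed for the lumped star.  What remains of item 1 (i): (c)
configuration vs lumped (an arrangement stage; law-dependent), and the untouched items (iii), (iv).  Literature grade (cell rule): OWN; nothing cited; no new bib keys.
-/

open Finset
open Literature.Probability.MarkovChains

namespace Summit.Ventures.LatticeQCDFlow.Scaling

section ClockMixing
variable {X : Type*} [Fintype X] [DecidableEq X] {S : Type*} [Fintype S] [DecidableEq S]
variable {hub : X → S} {comp : X → S → ℕ} {K : ℕ} {μ0 W θ : S → ℝ} {p σ c C : ℝ} {acc : S → S → ℝ} {Kh : (S → ℕ) → S → S → ℝ}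
variable {Δ : (S → ℕ) → (S → ℕ) → ℕ} {F Ψ : X × X → ℝ}
variable {NCf : X → X → S → ℕ} {af bf : X → X → S} {PXf PYf : X → X → Option S → Option S → ℝ} {xtf ytf xsf ysf : X → X → Option S → ℝ}
variable {Ast Bst Sst : X → X → ℝ} {g : (S → ℕ) → ℝ} {πS : X → ℝ} {Z : ℝ}

/-- **THE MIXING TIME OF THE LUMPED STAR IN STEPS, SHARP LOGARITHM** (see the module docstring). [ours] -/
theorem lumpedStar_clock_mixingTime_le [Nonempty X] (hinj : ∀ x x', hub x = hub x' → comp x = comp x' → x = x') (hsum : ∀ x, ∑ v, comp x v = K + 1)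
    (hsurj : ∀ (z : S) (N : S → ℕ), ∑ v, N v = K + 1 → N z ≠ 0 → ∃ x, hub x = z ∧ comp x = N) (hhub : ∀ x, comp x (hub x) ≠ 0) (hK : 2 ≤ K)
    (hW : ∀ v, 0 < W v) (hp0 : 0 ≤ p) (hp : ∀ v, p * W v ≤ 1) (hθ : ∀ v, θ v = 1 / (1 + p * W v)) (hacc : ∀ h v, acc h v = min 1 (W h / W v))
    (hμ0 : ∀ v, 0 ≤ μ0 v) (hμ1 : ∑ v, μ0 v = 1) (hμpos : ∀ v, 0 < μ0 v) (hc : 2 * (K : ℝ) + 4 ≤ c) (hσ0 : 0 < σ) (hσ1 : σ < 1)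
    (hgap : 0 < p * ∑ v, μ0 v * (W v * θ v))
    (hKoff : ∀ N h v, h ≠ v → Kh N h v = if N h = 0 then 0 else (N v : ℝ) / K * acc h v) (hKdiag : ∀ N h, Kh N h h = 1 - ∑ v ∈ univ.erase h, Kh N h v)
    (hΔ : ∀ N N', Δ N N' = ∑ v, (N v - N' v))
    (hF : ∀ x y, F (x, y) = c + (-(1 - σ) * θ (hub x)) + (-(1 - σ) * θ (hub y)) + ∑ v, θ v * ((comp x v : ℝ) + (comp y v : ℝ)))
    (hC : C = 2 * ((K + 1) * (c + 2 * K + 6)))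
    (hΨ : ∀ x y, Ψ (x, y) = (Δ (comp x) (comp y) : ℝ) * F (x, y) + C * (if hub x = hub y then (0 : ℝ) else 1))
    -- the tagged data of every ORIENTED adjacent pair (as in W23 ∕ X6)
    (horient : ∀ x y, hub x = hub y → Δ (comp x) (comp y) = 1 → W (bf x y) ≤ W (af x y) ∨ W (bf y x) ≤ W (af y x))
    (hcx : ∀ x y, hub x = hub y → Δ (comp x) (comp y) = 1 → W (bf x y) ≤ W (af x y) → comp x = NCf x y + Pi.single (af x y) 1)
    (hcy : ∀ x y, hub x = hub y → Δ (comp x) (comp y) = 1 → W (bf x y) ≤ W (af x y) → comp y = NCf x y + Pi.single (bf x y) 1)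
    (hPXoff : ∀ x y, hub x = hub y → Δ (comp x) (comp y) = 1 → W (bf x y) ≤ W (af x y) →
      ∀ h v, h ≠ v → PXf x y (some h) (some v) = if NCf x y h = 0 then 0 else (NCf x y v : ℝ) / K * acc h v)
    (hPXin : ∀ x y, hub x = hub y → Δ (comp x) (comp y) = 1 → W (bf x y) ≤ W (af x y) →
      ∀ h, PXf x y (some h) none = if NCf x y h = 0 then 0 else acc h (af x y) / K)
    (hPXdiag : ∀ x y, hub x = hub y → Δ (comp x) (comp y) = 1 → W (bf x y) ≤ W (af x y) →
      ∀ h, PXf x y (some h) (some h) = 1 - (∑ v ∈ univ.erase h, PXf x y (some h) (some v) + PXf x y (some h) none))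
    (hPXout : ∀ x y, hub x = hub y → Δ (comp x) (comp y) = 1 → W (bf x y) ≤ W (af x y) → ∀ v, PXf x y none (some v) = (NCf x y v : ℝ) / K * acc (af x y) v)
    (hPXstay : ∀ x y, hub x = hub y → Δ (comp x) (comp y) = 1 → W (bf x y) ≤ W (af x y) → PXf x y none none = 1 - ∑ v, PXf x y none (some v))
    (hPYoff : ∀ x y, hub x = hub y → Δ (comp x) (comp y) = 1 → W (bf x y) ≤ W (af x y) →
      ∀ h v, h ≠ v → PYf x y (some h) (some v) = if NCf x y h = 0 then 0 else (NCf x y v : ℝ) / K * acc h v)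
    (hPYin : ∀ x y, hub x = hub y → Δ (comp x) (comp y) = 1 → W (bf x y) ≤ W (af x y) →
      ∀ h, PYf x y (some h) none = if NCf x y h = 0 then 0 else acc h (bf x y) / K)
    (hPYdiag : ∀ x y, hub x = hub y → Δ (comp x) (comp y) = 1 → W (bf x y) ≤ W (af x y) →
      ∀ h, PYf x y (some h) (some h) = 1 - (∑ v ∈ univ.erase h, PYf x y (some h) (some v) + PYf x y (some h) none))
    (hPYout : ∀ x y, hub x = hub y → Δ (comp x) (comp y) = 1 → W (bf x y) ≤ W (af x y) → ∀ v, PYf x y none (some v) = (NCf x y v : ℝ) / K * acc (bf x y) v)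
    (hPYstay : ∀ x y, hub x = hub y → Δ (comp x) (comp y) = 1 → W (bf x y) ≤ W (af x y) → PYf x y none none = 1 - ∑ v, PYf x y none (some v))
    (hxtf : ∀ x y, hub x = hub y → Δ (comp x) (comp y) = 1 → W (bf x y) ≤ W (af x y) →
      ∀ t, xtf x y t = (1 - σ) * PXf x y (some (hub x)) t + σ * ∑ t', xtf x y t' * PXf x y t' t)
    (hytf : ∀ x y, hub x = hub y → Δ (comp x) (comp y) = 1 → W (bf x y) ≤ W (af x y) →
      ∀ t, ytf x y t = (1 - σ) * PYf x y (some (hub x)) t + σ * ∑ t', ytf x y t' * PYf x y t' t)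
    (hxsf : ∀ x y, hub x = hub y → Δ (comp x) (comp y) = 1 → W (bf x y) ≤ W (af x y) →
      ∀ t, xsf x y t = (1 - σ) * PXf x y none t + σ * ∑ t', xsf x y t' * PXf x y t' t)
    (hysf : ∀ x y, hub x = hub y → Δ (comp x) (comp y) = 1 → W (bf x y) ≤ W (af x y) →
      ∀ t, ysf x y t = (1 - σ) * PYf x y none t + σ * ∑ t', ysf x y t' * PYf x y t' t)
    -- the step chain of the lumped star (file X5 `LumpedStarStepChain`)
    (hA : ∀ x x', Ast x x' = if comp x' = comp x then Kh (comp x) (hub x) (hub x') else 0)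
    (hB : ∀ x x', Bst x x' = μ0 (hub x') * (if comp x' + Pi.single (hub x) 1 = comp x + Pi.single (hub x') 1 then 1 else 0))
    (hS : ∀ x x', Sst x x' = σ * Ast x x' + (1 - σ) * Bst x x')
    (hg : ∀ N, g N = ∏ v, (μ0 v * W v) ^ (N v) / ((N v).factorial : ℝ))
    (hZ : Z = ∑ x, g (comp x) * ((comp x (hub x) : ℝ) / W (hub x))) (hπS : ∀ x, πS x = g (comp x) * ((comp x (hub x) : ℝ) / W (hub x)) / Z)
    {ε₀ : ℝ} (hε₀ : 0 < ε₀) :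
    mixingTime Sst πS ε₀ ≤ ⌈(-Real.log ε₀ + Real.log (2 * (((K : ℝ) + 1) * (c + 2 * K + 2) + C) / (σ * (p * ∑ v, μ0 v * (W v * θ v)) / (c + 2 * K + 2))))
        / Real.log (1 + (1 - σ) * (σ * (p * ∑ v, μ0 v * (W v * θ v)) / (c + 2 * K + 2)) / 48)⌉₊ := by
  have hK0 : (0 : ℝ) ≤ K := Nat.cast_nonneg _
  have hcK : 0 < c + 2 * K + 2 := by linarith
  have hr : 0 < σ * (p * ∑ v, μ0 v * (W v * θ v)) / (c + 2 * K + 2) := div_pos (mul_pos hσ0 hgap) hcK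
  have hεpos : 0 < (1 - σ) * (σ * (p * ∑ v, μ0 v * (W v * θ v)) / (c + 2 * K + 2)) / 48 := div_pos (mul_pos (by linarith) hr) (by norm_num)
  have hα : 0 < Real.log (1 + (1 - σ) * (σ * (p * ∑ v, μ0 v * (W v * θ v)) / (c + 2 * K + 2)) / 48) := Real.log_pos (by linarith)
  refine mixingTime_le Sst πS ?_
  have hd := lumpedStar_clock_worstTvDist_le hinj hsum hsurj hhub hK hW hp0 hp hθ hacc hμ0 hμ1 hμpos hc hσ0 hσ1 hgap hKoff hKdiag hΔ hF hC hΨ horient hcx hcy hPXoff hPXin hPXdiag hPXout hPXstay hPYoff hPYin hPYdiag hPYout hPYstay hxtf hytf hxsf hysf hA hB hS hg hZ hπS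
    ⌈(-Real.log ε₀ + Real.log (2 * (((K : ℝ) + 1) * (c + 2 * K + 2) + C) / (σ * (p * ∑ v, μ0 v * (W v * θ v)) / (c + 2 * K + 2))))
        / Real.log (1 + (1 - σ) * (σ * (p * ∑ v, μ0 v * (W v * θ v)) / (c + 2 * K + 2)) / 48)⌉₊
  have hexp : (1 + (1 - σ) * (σ * (p * ∑ v, μ0 v * (W v * θ v)) / (c + 2 * K + 2)) / 48)⁻¹
      = Real.exp (-Real.log (1 + (1 - σ) * (σ * (p * ∑ v, μ0 v * (W v * θ v)) / (c + 2 * K + 2)) / 48)) := by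
    rw [Real.exp_neg, Real.exp_log (by linarith)]
  rw [hexp] at hd
  refine hd.trans ?_
  rw [mul_comm]
  exact exp_neg_pow_mul_le hα hε₀ (Nat.le_ceil _)

/-- **THE STEP-COUNT LAW AT `c = 2K+4` IN CLOSED FORM:** `t_mix^{steps}(ε₀) ≤ ⌈(192(2K+3)/((1−σ)σp̄))·(log(1/ε₀) + log(8(K+1)(6K+13)(2K+3)/(σp̄)))⌉`, `p̄ = pE_{μ_0}[Wθ]`,
`0 < ε₀ ≤ 1`. [ours] -/
theorem lumpedStar_clock_mixingTime_le_twoK [Nonempty X] (hinj : ∀ x x', hub x = hub x' → comp x = comp x' → x = x') (hsum : ∀ x, ∑ v, comp x v = K + 1)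
    (hsurj : ∀ (z : S) (N : S → ℕ), ∑ v, N v = K + 1 → N z ≠ 0 → ∃ x, hub x = z ∧ comp x = N) (hhub : ∀ x, comp x (hub x) ≠ 0) (hK : 2 ≤ K)
    (hW : ∀ v, 0 < W v) (hp0 : 0 ≤ p) (hp : ∀ v, p * W v ≤ 1) (hθ : ∀ v, θ v = 1 / (1 + p * W v)) (hacc : ∀ h v, acc h v = min 1 (W h / W v))
    (hμ0 : ∀ v, 0 ≤ μ0 v) (hμ1 : ∑ v, μ0 v = 1) (hμpos : ∀ v, 0 < μ0 v) (hσ0 : 0 < σ) (hσ1 : σ < 1)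
    (hgap : 0 < p * ∑ v, μ0 v * (W v * θ v))
    (hKoff : ∀ N h v, h ≠ v → Kh N h v = if N h = 0 then 0 else (N v : ℝ) / K * acc h v) (hKdiag : ∀ N h, Kh N h h = 1 - ∑ v ∈ univ.erase h, Kh N h v)
    (hΔ : ∀ N N', Δ N N' = ∑ v, (N v - N' v))
    (hF : ∀ x y, F (x, y) = (2 * (K : ℝ) + 4) + (-(1 - σ) * θ (hub x)) + (-(1 - σ) * θ (hub y)) + ∑ v, θ v * ((comp x v : ℝ) + (comp y v : ℝ)))
    (hC : C = 2 * ((K + 1) * ((2 * (K : ℝ) + 4) + 2 * K + 6)))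
    (hΨ : ∀ x y, Ψ (x, y) = (Δ (comp x) (comp y) : ℝ) * F (x, y) + C * (if hub x = hub y then (0 : ℝ) else 1))
    -- the tagged data of every ORIENTED adjacent pair (as in W23 ∕ X6)
    (horient : ∀ x y, hub x = hub y → Δ (comp x) (comp y) = 1 → W (bf x y) ≤ W (af x y) ∨ W (bf y x) ≤ W (af y x))
    (hcx : ∀ x y, hub x = hub y → Δ (comp x) (comp y) = 1 → W (bf x y) ≤ W (af x y) → comp x = NCf x y + Pi.single (af x y) 1)
    (hcy : ∀ x y, hub x = hub y → Δ (comp x) (comp y) = 1 → W (bf x y) ≤ W (af x y) → comp y = NCf x y + Pi.single (bf x y) 1)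
    (hPXoff : ∀ x y, hub x = hub y → Δ (comp x) (comp y) = 1 → W (bf x y) ≤ W (af x y) →
      ∀ h v, h ≠ v → PXf x y (some h) (some v) = if NCf x y h = 0 then 0 else (NCf x y v : ℝ) / K * acc h v)
    (hPXin : ∀ x y, hub x = hub y → Δ (comp x) (comp y) = 1 → W (bf x y) ≤ W (af x y) →
      ∀ h, PXf x y (some h) none = if NCf x y h = 0 then 0 else acc h (af x y) / K)
    (hPXdiag : ∀ x y, hub x = hub y → Δ (comp x) (comp y) = 1 → W (bf x y) ≤ W (af x y) →
      ∀ h, PXf x y (some h) (some h) = 1 - (∑ v ∈ univ.erase h, PXf x y (some h) (some v) + PXf x y (some h) none))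
    (hPXout : ∀ x y, hub x = hub y → Δ (comp x) (comp y) = 1 → W (bf x y) ≤ W (af x y) → ∀ v, PXf x y none (some v) = (NCf x y v : ℝ) / K * acc (af x y) v)
    (hPXstay : ∀ x y, hub x = hub y → Δ (comp x) (comp y) = 1 → W (bf x y) ≤ W (af x y) → PXf x y none none = 1 - ∑ v, PXf x y none (some v))
    (hPYoff : ∀ x y, hub x = hub y → Δ (comp x) (comp y) = 1 → W (bf x y) ≤ W (af x y) →
      ∀ h v, h ≠ v → PYf x y (some h) (some v) = if NCf x y h = 0 then 0 else (NCf x y v : ℝ) / K * acc h v)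
    (hPYin : ∀ x y, hub x = hub y → Δ (comp x) (comp y) = 1 → W (bf x y) ≤ W (af x y) →
      ∀ h, PYf x y (some h) none = if NCf x y h = 0 then 0 else acc h (bf x y) / K)
    (hPYdiag : ∀ x y, hub x = hub y → Δ (comp x) (comp y) = 1 → W (bf x y) ≤ W (af x y) →
      ∀ h, PYf x y (some h) (some h) = 1 - (∑ v ∈ univ.erase h, PYf x y (some h) (some v) + PYf x y (some h) none))
    (hPYout : ∀ x y, hub x = hub y → Δ (comp x) (comp y) = 1 → W (bf x y) ≤ W (af x y) → ∀ v, PYf x y none (some v) = (NCf x y v : ℝ) / K * acc (bf x y) v)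
    (hPYstay : ∀ x y, hub x = hub y → Δ (comp x) (comp y) = 1 → W (bf x y) ≤ W (af x y) → PYf x y none none = 1 - ∑ v, PYf x y none (some v))
    (hxtf : ∀ x y, hub x = hub y → Δ (comp x) (comp y) = 1 → W (bf x y) ≤ W (af x y) →
      ∀ t, xtf x y t = (1 - σ) * PXf x y (some (hub x)) t + σ * ∑ t', xtf x y t' * PXf x y t' t)
    (hytf : ∀ x y, hub x = hub y → Δ (comp x) (comp y) = 1 → W (bf x y) ≤ W (af x y) →
      ∀ t, ytf x y t = (1 - σ) * PYf x y (some (hub x)) t + σ * ∑ t', ytf x y t' * PYf x y t' t)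
    (hxsf : ∀ x y, hub x = hub y → Δ (comp x) (comp y) = 1 → W (bf x y) ≤ W (af x y) →
      ∀ t, xsf x y t = (1 - σ) * PXf x y none t + σ * ∑ t', xsf x y t' * PXf x y t' t)
    (hysf : ∀ x y, hub x = hub y → Δ (comp x) (comp y) = 1 → W (bf x y) ≤ W (af x y) →
      ∀ t, ysf x y t = (1 - σ) * PYf x y none t + σ * ∑ t', ysf x y t' * PYf x y t' t)
    -- the step chain of the lumped star (file X5 `LumpedStarStepChain`)
    (hA : ∀ x x', Ast x x' = if comp x' = comp x then Kh (comp x) (hub x) (hub x') else 0)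
    (hB : ∀ x x', Bst x x' = μ0 (hub x') * (if comp x' + Pi.single (hub x) 1 = comp x + Pi.single (hub x') 1 then 1 else 0))
    (hS : ∀ x x', Sst x x' = σ * Ast x x' + (1 - σ) * Bst x x')
    (hg : ∀ N, g N = ∏ v, (μ0 v * W v) ^ (N v) / ((N v).factorial : ℝ))
    (hZ : Z = ∑ x, g (comp x) * ((comp x (hub x) : ℝ) / W (hub x))) (hπS : ∀ x, πS x = g (comp x) * ((comp x (hub x) : ℝ) / W (hub x)) / Z)
    {ε₀ : ℝ} (hε₀ : 0 < ε₀) (hε₁ : ε₀ ≤ 1) :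
    mixingTime Sst πS ε₀ ≤ ⌈192 * (2 * (K : ℝ) + 3) / ((1 - σ) * (σ * (p * ∑ v, μ0 v * (W v * θ v))))
        * (Real.log (1 / ε₀) + Real.log (8 * ((K : ℝ) + 1) * (6 * K + 13) * (2 * K + 3) / (σ * (p * ∑ v, μ0 v * (W v * θ v)))))⌉₊ := by
  have hK0 : (0 : ℝ) ≤ K := Nat.cast_nonneg _
  have hpbar : p * ∑ v, μ0 v * (W v * θ v) ≤ 1 / 2 := by
    calc p * ∑ v, μ0 v * (W v * θ v) = ∑ v, μ0 v * (p * (W v * θ v)) := by rw [mul_sum]; exact sum_congr rfl fun v _ => by ring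
      _ ≤ ∑ v, μ0 v * (1 / 2) := sum_le_sum fun v _ => mul_le_mul_of_nonneg_left (finiteOdds_pWθ_le_half hp0 hp hW hθ v) (hμ0 v)
      _ = 1 / 2 := by rw [← sum_mul, hμ1, one_mul]
  have h := lumpedStar_clock_mixingTime_le (c := 2 * (K : ℝ) + 4) hinj hsum hsurj hhub hK hW hp0 hp hθ hacc hμ0 hμ1 hμpos (le_refl _) hσ0 hσ1 hgap hKoff hKdiag hΔ hF hC hΨ horient hcx hcy hPXoff hPXin hPXdiag hPXout hPXstay hPYoff hPYin hPYdiag hPYout hPYstay hxtf hytf hxsf hysf hA hB hS hg hZ hπS hε₀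
  refine h.trans (Nat.ceil_mono ?_)
  -- the scalars
  set pb : ℝ := p * ∑ v, μ0 v * (W v * θ v) with hpb
  have hσpb : 0 < σ * pb := mul_pos hσ0 hgap
  have hσpb1 : σ * pb ≤ 1 / 2 := by
    have := mul_le_mul hσ1.le hpbar hgap.le zero_le_one; linarith
  set ε : ℝ := (1 - σ) * (σ * pb / ((2 * (K : ℝ) + 4) + 2 * K + 2)) / 48 with hεdef
  have hεeq : ε = (1 - σ) * (σ * pb) / (96 * (2 * K + 3)) := by rw [hεdef]; field_simp; ring
  have hε0 : 0 < ε := by rw [hεeq]; exact div_pos (mul_pos (by linarith) hσpb) (by linarith)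
  have hε1 : ε ≤ 1 := by
    rw [hεeq, div_le_one (by linarith)]
    have : (1 - σ) * (σ * pb) ≤ 1 * (1 / 2) := mul_le_mul (by linarith) hσpb1 hσpb.le zero_le_one
    linarith
  -- `log(1+ε) ≥ ε/(1+ε) ≥ ε/2`
  have hlog : ε / 2 ≤ Real.log (1 + ε) := by
    have h1 := Real.one_sub_inv_le_log_of_pos (by linarith : (0 : ℝ) < 1 + ε)
    have h2 : 1 - (1 + ε)⁻¹ = ε / (1 + ε) := by field_simp; ring
    rw [h2] at h1
    exact le_trans (div_le_div_of_nonneg_left hε0.le (by linarith) (by linarith)) h1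
  -- the argument of the logarithm
  have hD : 2 * (((K : ℝ) + 1) * ((2 * (K : ℝ) + 4) + 2 * K + 2) + C) / (σ * pb / ((2 * (K : ℝ) + 4) + 2 * K + 2))
      = 8 * ((K : ℝ) + 1) * (6 * K + 13) * (2 * K + 3) / (σ * pb) := by
    rw [hC]; field_simp; ring
  have hbig : 1 ≤ 8 * ((K : ℝ) + 1) * (6 * K + 13) * (2 * K + 3) / (σ * pb) := by
    rw [le_div_iff₀ hσpb]
    have hK2' : 0 ≤ (K : ℝ) * K := mul_nonneg hK0 hK0
    have hK3' : 0 ≤ (K : ℝ) * K * K := mul_nonneg hK2' hK0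
    nlinarith [hK2', hK3', hσpb1]
  have hA0 : 0 ≤ Real.log (1 / ε₀) + Real.log (8 * ((K : ℝ) + 1) * (6 * K + 13) * (2 * K + 3) / (σ * pb)) :=
    add_nonneg (Real.log_nonneg (by rw [le_div_iff₀ hε₀]; linarith)) (Real.log_nonneg hbig)
  have hlog1 : -Real.log ε₀ = Real.log (1 / ε₀) := by rw [one_div, Real.log_inv]
  rw [hD, hlog1]
  calc (Real.log (1 / ε₀) + Real.log (8 * ((K : ℝ) + 1) * (6 * K + 13) * (2 * K + 3) / (σ * pb))) / Real.log (1 + ε)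
      ≤ (Real.log (1 / ε₀) + Real.log (8 * ((K : ℝ) + 1) * (6 * K + 13) * (2 * K + 3) / (σ * pb))) / (ε / 2) :=
        div_le_div_of_nonneg_left hA0 (by linarith) hlog
    _ = 192 * (2 * (K : ℝ) + 3) / ((1 - σ) * (σ * pb))
        * (Real.log (1 / ε₀) + Real.log (8 * ((K : ℝ) + 1) * (6 * K + 13) * (2 * K + 3) / (σ * pb))) := by
        rw [hεeq]
        have h1σ : (1 - σ) ≠ 0 := by linarith
        field_simp
        ring

end ClockMixing

end Summit.Ventures.LatticeQCDFlow.Scaling
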